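import Summits.MatrixMultiplication.MatrixMultiplication.Theses.LevelGradedCohnUmans
import Summits.MatrixMultiplication.MatrixMultiplication.Theorems.LevelTwoBeatsCubes.Negative.GradedNeumannCount
import Summits.MatrixMultiplication.MatrixMultiplication.Theorems.LevelGradedCohnUmansGradedPricing
import Summits.MatrixMultiplication.MatrixMultiplication.Theorems.LevelGradedCohnUmansGradedDesignFamilyStubColourPricing
import Summits.MatrixMultiplication.MatrixMultiplication.Theorems.LevelGradedCohnUmansGradedDesignFamilyStubTwoRowBudgetRate
import Summits.MatrixMultiplication.MatrixMultiplication.Theorems.LevelGradedCohnUmansGradedDesignFamilyYoungTPP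

/-!
# Line `schur-weyl-colour-cells` — skeleton for the crux `LevelGradedCohnUmans.GradedDesignFamily`
(crux item stmt-MatrixMultiplication-7610, the route TARGET, auto-crux rank 0; planner crux-plan seat,
round 1; idea card `Cruxes/GradedDesignFamily/Ideas/schur-weyl-colour-cells.md`, triage r1-1 / r1-2: pass)

THE LINE.  A third engine for the graded design family, on the symmetric-group side, living in a
FIXED-PARAMETER UNIVERSALITY CELL.  For `r ≥ 2` let `J_r(n) ≤ ℂ^{𝔖ₙ}` be the **colour cell**:
the span of the colouring-incidence tests `g ↦ [c' ∘ g = c]` (`c, c' : [n] → [r]`), i.e. the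
coefficient space of the Schur–Weyl module `(ℂ^r)^{⊗n}` (`colourSpace n r`).  It is bi-invariant
(`colourSpace_biInvariant`, PROVED), its irreducible constituents are the `χ_μ` with AT MOST `r`
ROWS (Schur–Weyl duality / Young's rule — STUB A `stub_colourPricing`, the `r`-row twin of the
route's PROVED support item `TokenBudget`), so the crux's price at `J = J_r(n)` is
`B_s(r,n) = Σ_{ℓ(μ) ≤ r} (f^μ)^s` and its wall is `D_r(n) = Σ_{ℓ(μ) ≤ r} (f^μ)² = #{lds ≤ r}`
(`= C_n`, Catalan, at `r = 2`).  THE POINT (card § Why it bites, re-derived by both triagers): at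
FIXED `r` the effective number of comparable blocks `N_eff = D_r / max f²` grows like `n^{(r-1)/2}`
(`0.60 √n` at `r = 2`), so `B_s(r,n) ≲ D_r(n)^{s/2} · n^{-(r-1)(s-2)/4}` for `s > 2` — Regev's
strip asymptotics; at `r = 2` an elementary ballot-number computation: STUB B
`stub_twoRowBudgetRate`, stated against the explicit proxy wall `P(n) = 4^n / n^{3/2} ≍ √π · C_n`
(so that only UPPER bounds on two-row degrees are needed) and with an unspecified rate `n^{-θ}`,
`θ = θ(s) > 0` (the truth is `θ = (s-2)/4`; any `θ > 0` drives the engine) — and therefore designs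
within EVERY POLYNOMIAL LOSS `n^{-a}` of the wall along infinitely many `n`, at ONE `r`, already
yield the crux for EVERY `ε` (in particular constant-factor saturation does:
`twoColourWallFamily_of_constant`, PROVED).  No such cell exists among the route's token levels
(`N_eff` bounded at each level: the refutation `LevelTwoBeatsCubes_refuted` and the forced double
limit `k → ∞` of `SnLevelDesigns`).  The whole open content is therefore ONE ε-free, character-free
statement, STUB C `stub_twoColourWallFamily` = the crux READ INSIDE THE TWO-COLOUR CELLS (triage
r1-1's "make C⁺⁺(r = 2) the line's crux", in its weakest composable form): for every `a > 0` and
infinitely many `n`, a `2`-colour-separated triple `X, Y, Z ⊆ 𝔖ₙ` with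
`|X||Y||Z| ≥ P(n)^{3/2} n^{-a} = 8^n / n^{9/4 + a}`.  `GradedDesignFamily_of` composes A, B, C into
the crux BY NAME (real proof: the ε-bookkeeping of the card's `ColourUniversality` with rates, done
once for an arbitrary positive wall function in `gradedDesignFamily_of_wall`: given `ε`, take
`θ = θ(2+ε)` from B, `a = 3θ/(2(2+ε))` in C and `n` past `K^{2/θ}`); the same engine gives the
documented RESHAPE to any fixed `r ≥ 1` (`GradedDesignFamily_of_rows : ColourPricing →
RowUniversality r → RowWallFamily r → crux`, PROVED, hypotheses = Regev's rate at level `r` against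
the abstract wall `D_r(n)` and the `D_r`-wall family; not registered).

TOOLS FOR THE LEAD (proved here, not stubs): `colourSeparated_of_incidence` (one colouring
incidence through the target that misses the rest of the quadruple set certifies the target — the
set-image test `[g(A) = B]` at `r = 2`); `colourSeparated_tpp` (colour designs are TPP triples, via
the landed `SepImpliesTPP_proof`); the walls `colourSeparated_volume_sq_le`,
`colourSeparated_packing_X` (landed graded Neumann count) and `finrank_colourSpace_le` (under A,
`dim J_r(n) ≤ D_r(n)`), so C asks for nothing the walls forbid: `c ≤ (D_2/P)^{3/2} → π^{-3/4}`,
and the sharp cap `V ≤ ψ(D) ≈ 0.385 D^{3/2}` (Disproof `vol_le_psi`) puts `c ≤ 0.163`.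

CONVENTIONS.  `(g * h) i = g (h i)` (Mathlib); products are read `x⁻¹ * y * y'⁻¹ * z` exactly as in
the crux; a colouring-incidence test is `colourTest c c' g = [c' ∘ ⇑g = c]`; for `r = 2` it is the
set-image event `[g(c⁻¹ 0) = c'⁻¹ 0]` (a left coset of the Young subgroup `Sym(c⁻¹0) × Sym(c⁻¹1)`).
`rowDegreeSum n r s = Σ_{μ ⊢ n, #parts ≤ r} (f^μ)^s` with the tree's `numStandardTableaux`.

DISPROOF USED (`Cruxes/GradedDesignFamily/Disproof.lean`, cdisprove cycle 1, verdict NO KILL; no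
`_false_without_<H>` theorem names a removable hypothesis — the four LOAD-BEARING clauses are
`realizable_without_biInv/_zeros/_ones`, `realizable_with_le`): the skeleton keeps all four —
`J = colourSpace n 2` is bi-invariant BY PROOF, `ColourSeparated` is the crux's exact 0/1 clause
(`colourSeparated_iff_sep : … ↔ Disproof-style Sep := Iff.rfl` below), and the composition proves
the STRICT inequality; `exists_abelian_witness_iff` (abelian hosts only for `ε > 1`): hosts are
`𝔖ₙ`, `n → ∞`; `no_fixed_host` / `no_witness_of_small_eps` / `nblocks_law` / `packing_law_sharp`
(every witness needs `#(Irr ∩ J)^ε > 2^{(2+ε)/3}`, i.e. `≈ e^{1.27/ε}` comparable blocks and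
near-extremal packing): met STRUCTURALLY — C is a family along `n → ∞` at fixed `r = 2` where
`N_eff ≍ √n → ∞`, and B is exactly the statement that the block count outruns every `ε`;
`vol_le_psi` / the landed `volume_sq_le_finrank_cube`, `packing_X/Z`: APPLIED to colour designs
below; `card_mul_add_card_mul_le_card` (pigeonhole for proper `J`): vacuous here
(`|X||Y| ≍ 4^n ≪ n!`).  Landed Negative lemmas checked against: imported
`LevelTwoBeatsCubes.Negative.GradedNeumannCount`; read and re-derived here (farm image not yet built)
`GradedDesignFamily.Negative.{ExponentTwoEndpoint, LoadBearing, Pigeonhole}` — no stub is an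
instance of any (C is NOT a fixed
cell at exponent 3: the refuted `LevelTwoBeatsCubes` pattern; it is a `∀ n₀ ∃ n ≥ n₀` statement, and
the two-ROW cell differs from the level-2 cell for every `n ≥ 4`).  Negatives index (4 refuted
statements of the summit): level-2-beats-cubes, two finite-field STPP designs, design flattening —
none restated.

TRIAGE ANSWERS.  r1-1 (sharpen: make `C⁺⁺(r=2)` explicit as the line's crux; its falsifier
`ρ_n = V_max/C_n^{3/2}`, `n = 5..8`, is a kit job for the lead): done — STUB C is `C⁺⁺(2)` verbatim up
to the proxy constant, and the line card specifies the job.  r1-2 (record the transpose symmetry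
`sgn · J_r = J_{n-r-1}^⊥`, colour cell = CO-LEVEL cell, so the chain's RSS/KL certificate code is
reusable with `lis ↔ lds`): recorded in the line card with the corrected straightening direction
(`Ann (ℂ^r)^{⊗n} = ⟨C_w : lds w > r⟩`, garbage straightens Bruhat-DOWNWARD onto `{lds ≤ r}`, so the
sibling line's Bruhat shield transfers with `schenstedSet ↦ {lds ≤ r}`); deliberately NOT made a
stub: at constant-factor tolerance a lossy sufficient certificate could be false while C is true.
r1-2 (doubt: flattening-injective product sets fill only `n^{-3/2}` of the pair wall): recorded as
the first dead architecture under "Hardest stub".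
-/

set_option linter.dupNamespace false

noncomputable section

open scoped BigOperators

namespace Summit.MatrixMultiplication.MatrixMultiplication.Cruxes.GradedDesignFamily.SchurWeylColourCells

open Module
open Summit.MatrixMultiplication.MatrixMultiplication.Theses.LevelGradedCohnUmans
open Summit.MatrixMultiplication.MatrixMultiplication.Theorems (GradedPricing.le_repFun_charSupport
  GradedPricing.sum_charSupport_rpow_le)
open Literature.RepresentationTheory.FiniteGroups (irrChars exists_algEquiv_pi_matrix blockRep)
open Literature.Computability.AlgebraicComplexity (repFun)
open Literature.NumberTheory.DiophantineGeometry (numStandardTableaux)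

/-! ## Objects -/

/-- The colouring-incidence test `g ↦ [c' ∘ g = c]` of two `r`-colourings `c, c' : [n] → [r]`
(a matrix coefficient `⟨g · e_c, e_{c'}⟩` of `(ℂ^r)^{⊗n}`; for `r = 2` the set-image event
`[g (c⁻¹ 0) = c'⁻¹ 0]`). -/
def colourTest {n r : ℕ} (c c' : Fin n → Fin r) : Equiv.Perm (Fin n) → ℂ :=
  fun g => if c' ∘ (⇑g) = c then 1 else 0

/-- The **colour cell** `J_r(n)`: the span of the colouring-incidence tests, i.e. the coefficient
space of the Schur–Weyl module `(ℂ^r)^{⊗n}` (irreducible constituents: `χ_μ`, `ℓ(μ) ≤ r`). -/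
def colourSpace (n r : ℕ) : Submodule ℂ (Equiv.Perm (Fin n) → ℂ) :=
  Submodule.span ℂ {f | ∃ c c' : Fin n → Fin r, f = colourTest c c'}

/-- `r`-colour separation of a triple: the separation clause of `GradedDesignFamily` VERBATIM with
`J := colourSpace n r`. -/
def ColourSeparated (n r : ℕ) (X Y Z : Finset (Equiv.Perm (Fin n))) : Prop :=
  ∀ x₀ ∈ X, ∀ z₀ ∈ Z, ∃ f ∈ colourSpace n r, ∀ x ∈ X, ∀ y ∈ Y, ∀ y' ∈ Y, ∀ z ∈ Z,
    (x = x₀ ∧ y = y' ∧ z = z₀ → f (x⁻¹ * y * y'⁻¹ * z) = 1) ∧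
    (¬ (x = x₀ ∧ y = y' ∧ z = z₀) → f (x⁻¹ * y * y'⁻¹ * z) = 0)

/-- The crux's graded price at `J = J_r(n)`: `Σᶠ_{χ ∈ Irr(𝔖ₙ) ∩ J_r(n)} χ(1)^s`. -/
def colourBudget (n r : ℕ) (s : ℝ) : ℝ :=
  ∑ᶠ χ ∈ irrChars (Equiv.Perm (Fin n)) ∩ (colourSpace n r : Set (Equiv.Perm (Fin n) → ℂ)),
    (χ 1).re ^ s

/-- The row-restricted degree sum `B_s(r,n) = Σ_{μ ⊢ n, ℓ(μ) ≤ r} (f^μ)^s`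
(`B_2(r,n) = D_r(n) = #{g ∈ 𝔖ₙ : lds g ≤ r}` by RSK; `D_2(n) = C_n`). -/
def rowDegreeSum (n r : ℕ) (s : ℝ) : ℝ :=
  ∑ μ : Nat.Partition n, if Multiset.card μ.parts ≤ r then (numStandardTableaux μ : ℝ) ^ s else 0

/-- The explicit two-row proxy wall `P(n) = 4^n / n^{3/2}` (`C_n ∼ P(n)/√π`; Regev 1981, or
Stirling on `C_n = C(2n,n)/(n+1)`). -/
def twoRowProxy (n : ℕ) : ℝ := (4 : ℝ) ^ n / (n : ℝ) ^ ((3 : ℝ) / 2)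

/-! ## The engine, abstractly: budget rates and wall families against a wall function `W` -/

/-- Budget rate at row level `r` against a wall function `W`: for every exponent `s > 2` there are
`K` and `θ > 0` with `B_s(r,n) ≤ K · W(n)^{s/2} · n^{-θ}` for all `n ≥ 1` (fixed-`r` universality
with a rate: the block count outruns every `ε` polynomially; Regev: `θ = (r-1)(s-2)/4` for
`W = D_r`). -/
def BudgetRate (r : ℕ) (W : ℕ → ℝ) : Prop :=
  ∀ s : ℝ, 2 < s → ∃ K θ : ℝ, 0 < θ ∧ ∀ n : ℕ, 1 ≤ n →
    rowDegreeSum n r s ≤ K * W n ^ (s / 2) * (n : ℝ) ^ (-θ)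

/-- A wall family at row level `r` against `W`, within every polynomial loss: for every `a > 0` and
infinitely many `n`, an `r`-colour-separated triple of volume `≥ W(n)^{3/2} · n^{-a}`. -/
def WallFamily (r : ℕ) (W : ℕ → ℝ) : Prop :=
  ∀ a : ℝ, 0 < a → ∀ n₀ : ℕ, ∃ n : ℕ, n₀ ≤ n ∧ ∃ X Y Z : Finset (Equiv.Perm (Fin n)),
    ColourSeparated n r X Y Z ∧
      W n ^ ((3 : ℝ) / 2) * (n : ℝ) ^ (-a) ≤ ((X.card * Y.card * Z.card : ℕ) : ℝ)

/-- The constant-factor form (the card's `C⁺⁺` literally): ONE `c > 0` and, for infinitely many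
`n`, an `r`-colour-separated triple of volume `≥ c · W(n)^{3/2}`.  It implies `WallFamily`
(`wallFamily_of_constant`). -/
def ConstantWallFamily (r : ℕ) (W : ℕ → ℝ) : Prop :=
  ∃ c : ℝ, 0 < c ∧ ∀ n₀ : ℕ, ∃ n : ℕ, n₀ ≤ n ∧ ∃ X Y Z : Finset (Equiv.Perm (Fin n)),
    ColourSeparated n r X Y Z ∧
      c * W n ^ ((3 : ℝ) / 2) ≤ ((X.card * Y.card * Z.card : ℕ) : ℝ)

/-! ## The three stub statements (named `Prop`s) -/

/-- STUB A — **Schur–Weyl pricing** (`r`-row twin of the route's `TokenBudget` = EFP Thm 7):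
every irreducible character of `𝔖ₙ` lying in the colour cell `J_r(n)` is `χ_μ` with `ℓ(μ) ≤ r`, so
for every real `s` the graded price is at most `B_s(r,n)`.  Known (Schur–Weyl duality, Young's
rule for the permutation module on `r`-colourings); the tree's `WordIsotypicDominance`
(`card_filter_lt_le_of_wordIsotypicMatrix_diag_ne_zero`: weights of `P_λ` on words in `r` letters
are dominated by `λ`, hence `ℓ(λ) ≤ r`) and the `tokenBudget_proof` template make it size M. -/
def ColourPricing : Prop :=
  ∀ (n r : ℕ) (s : ℝ), colourBudget n r s ≤ rowDegreeSum n r s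

/-- STUB B — **two-row budget rate** (Regev's strip asymptotics at `r = 2`, upper half, proxy
form): for `s > 2`, `Σ_{j ≤ n/2} (f^{(n-j,j)})^s ≤ K · (4^n/n^{3/2})^{s/2} · n^{-θ}` for all `n ≥ 1`,
with some `K` and `θ > 0` — by the ballot formula `f^{(n-j,j)} = C(n,j)(n-2j+1)/(n-j+1)` (hook
formula, PROVED in the tree) and the Gaussian profile of `C(n,j)`: LHS `≍ 2^{sn} n^{-s+1/2}`, so the
sharp rate is `θ = (s-2)/4` (numerically `LHS · n^{(s-2)/4} / P^{s/2} → 0.44, 0.49, 0.53` at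
`s = 3, 2.5, 2.2`).  Known, size M. -/
def TwoRowBudgetRate : Prop :=
  BudgetRate 2 twoRowProxy

/-- STUB C (hardest, OPEN) — **two-colour wall family** = the crux read inside the two-colour cells,
ε-free and character-free: for every `a > 0` and infinitely many `n`, a `2`-colour-separated triple
`X, Y, Z ⊆ 𝔖ₙ` with `|X||Y||Z| ≥ (4^n/n^{3/2})^{3/2} · n^{-a} = 8^n / n^{9/4 + a}` (the graded
Neumann cap is `ψ(C_n) ≈ 0.163 · 8^n/n^{9/4}`; each of `|X|, |Y|, |Z|` is then `2^n n^{-3/4 - O(a)}`).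
Any constant-factor family (`TwoColourConstantFamily`, the card's `C⁺⁺`) proves it. -/
def TwoColourWallFamily : Prop :=
  WallFamily 2 twoRowProxy

/-- The constant-factor target for constructors (card `C⁺⁺`; implies STUB C by
`twoColourWallFamily_of_constant`): `∃ c > 0`, infinitely many `n`, a `2`-colour-separated triple
with `|X||Y||Z| ≥ c · 8^n/n^{9/4}` (`c ≤ 0.163` forced). -/
def TwoColourConstantFamily : Prop :=
  ConstantWallFamily 2 twoRowProxy

/-! ## The registered stubs

RESHAPE (lead c1, 2026-08-16; v4: A, B and the Young-TPP tool LANDED and imported): the three registered `stub_*` theorems are spelled in TREE-ONLY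
vocabulary (`irrChars`, `numStandardTableaux`, `Submodule.span`, `Equiv.Perm`, `Finset`, `Real.rpow`;
every local definition unfolded), so that a `Theorems/` helper file can carry the IDENTICAL name and
signature without importing this Cruxes file; each is definitionally the named `Prop` above
(`colourPricing_iff`, `twoRowBudgetRate_iff`, `twoColourWallFamily_iff` are `Iff.rfl`). -/

/-- STUB A (Schur–Weyl pricing; size M, known) — LANDED (wave 1, p97462,
`Theorems/LevelGradedCohnUmansGradedDesignFamilyStubColourPricing.lean`, namespace
`…Theorems.GradedDesignFamily`): `Σᶠ_{χ ∈ Irr(𝔖ₙ) ∩ J_r(n)} χ(1)^s ≤ Σ_{ℓ(μ) ≤ r} (f^μ)^s`.  Here it is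
IMPORTED. -/
theorem colourPricing_holds : ColourPricing := fun n r s =>
  Summit.MatrixMultiplication.MatrixMultiplication.Theorems.GradedDesignFamily.stub_colourPricing n r s

/-- STUB B (two-row budget rate; size M, known/elementary) — LANDED (wave 1, p101413,
`Theorems/LevelGradedCohnUmansGradedDesignFamilyStubTwoRowBudgetRate.lean`, θ = (s-2)/4,
K = 32·32^{(s-1)/2}): for `s > 2` there are `K` and `θ > 0` with
`Σ_{ℓ(μ) ≤ 2} (f^μ)^s ≤ K · (4^n / n^{3/2})^{s/2} · n^{-θ}` for all `n ≥ 1`.  IMPORTED. -/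
theorem twoRowBudgetRate_holds : TwoRowBudgetRate := fun s hs =>
  Summit.MatrixMultiplication.MatrixMultiplication.Theorems.GradedDesignFamily.stub_twoRowBudgetRate s hs

/-- STUB C (the construction; size XL, OPEN — the line stands or falls here): for every `a > 0` and
every `n₀` some `n ≥ n₀` carries a `2`-colour-separated triple `X, Y, Z ⊆ 𝔖ₙ` of volume
`≥ (4^n/n^{3/2})^{3/2} · n^{-a}`. -/
theorem stub_twoColourWallFamily (a : ℝ) (ha : 0 < a) (n₀ : ℕ) :
    ∃ n : ℕ, n₀ ≤ n ∧ ∃ X Y Z : Finset (Equiv.Perm (Fin n)),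
      (∀ x₀ ∈ X, ∀ z₀ ∈ Z, ∃ f ∈ Submodule.span ℂ {f : Equiv.Perm (Fin n) → ℂ |
          ∃ c c' : Fin n → Fin 2, f = fun g : Equiv.Perm (Fin n) => if c' ∘ (⇑g) = c then (1 : ℂ) else 0},
        ∀ x ∈ X, ∀ y ∈ Y, ∀ y' ∈ Y, ∀ z ∈ Z,
          (x = x₀ ∧ y = y' ∧ z = z₀ → f (x⁻¹ * y * y'⁻¹ * z) = 1) ∧
          (¬ (x = x₀ ∧ y = y' ∧ z = z₀) → f (x⁻¹ * y * y'⁻¹ * z) = 0)) ∧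
      ((4 : ℝ) ^ n / (n : ℝ) ^ ((3 : ℝ) / 2)) ^ ((3 : ℝ) / 2) * (n : ℝ) ^ (-a) ≤
        ((X.card * Y.card * Z.card : ℕ) : ℝ) := by
  sorry

/-- The registered spelling of STUB A is the named statement (definitional). -/
theorem colourPricing_iff :
    ColourPricing ↔ ∀ (n r : ℕ) (s : ℝ),
      (∑ᶠ χ ∈ Literature.RepresentationTheory.FiniteGroups.irrChars (Equiv.Perm (Fin n)) ∩
        ((Submodule.span ℂ {f : Equiv.Perm (Fin n) → ℂ | ∃ c c' : Fin n → Fin r,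
            f = fun g : Equiv.Perm (Fin n) => if c' ∘ (⇑g) = c then (1 : ℂ) else 0}) :
          Set (Equiv.Perm (Fin n) → ℂ)), (χ 1).re ^ s) ≤
      ∑ μ : Nat.Partition n, if Multiset.card μ.parts ≤ r then
        (Literature.NumberTheory.DiophantineGeometry.numStandardTableaux μ : ℝ) ^ s else 0 :=
  Iff.rfl

/-- The registered spelling of STUB B is the named statement (definitional). -/
theorem twoRowBudgetRate_iff :
    TwoRowBudgetRate ↔ ∀ s : ℝ, 2 < s → ∃ K θ : ℝ, 0 < θ ∧ ∀ n : ℕ, 1 ≤ n →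
      (∑ μ : Nat.Partition n, if Multiset.card μ.parts ≤ 2 then
          (Literature.NumberTheory.DiophantineGeometry.numStandardTableaux μ : ℝ) ^ s else 0) ≤
        K * ((4 : ℝ) ^ n / (n : ℝ) ^ ((3 : ℝ) / 2)) ^ (s / 2) * (n : ℝ) ^ (-θ) :=
  Iff.rfl

/-- The registered spelling of STUB C is the named statement (definitional). -/
theorem twoColourWallFamily_iff :
    TwoColourWallFamily ↔ ∀ a : ℝ, 0 < a → ∀ n₀ : ℕ,
      ∃ n : ℕ, n₀ ≤ n ∧ ∃ X Y Z : Finset (Equiv.Perm (Fin n)),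
      (∀ x₀ ∈ X, ∀ z₀ ∈ Z, ∃ f ∈ Submodule.span ℂ {f : Equiv.Perm (Fin n) → ℂ |
          ∃ c c' : Fin n → Fin 2, f = fun g : Equiv.Perm (Fin n) => if c' ∘ (⇑g) = c then (1 : ℂ) else 0},
        ∀ x ∈ X, ∀ y ∈ Y, ∀ y' ∈ Y, ∀ z ∈ Z,
          (x = x₀ ∧ y = y' ∧ z = z₀ → f (x⁻¹ * y * y'⁻¹ * z) = 1) ∧
          (¬ (x = x₀ ∧ y = y' ∧ z = z₀) → f (x⁻¹ * y * y'⁻¹ * z) = 0)) ∧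
      ((4 : ℝ) ^ n / (n : ℝ) ^ ((3 : ℝ) / 2)) ^ ((3 : ℝ) / 2) * (n : ℝ) ^ (-a) ≤
        ((X.card * Y.card * Z.card : ℕ) : ℝ) :=
  Iff.rfl

/-! ## Name-keyed alias of the open statement (hypothesis of the composition; same device as
`Cruxes/SnLevelDesigns/Lines/lis-bruhat-shield.lean`) -/
namespace Registered

/-- Alias of `TwoColourWallFamily` (`C⁺⁺`). -/
abbrev stub_twoColourWallFamily : Prop := TwoColourWallFamily

end Registered

/-! ## Bi-invariance of the colour cell (proved; after `SketchIdeator1.colourSpace_biInvariant`) -/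

/-- The two-sided translation operator `f ↦ (g ↦ f (a g b))` as a linear map. -/
def biTranslate {G : Type} [Group G] (a b : G) : (G → ℂ) →ₗ[ℂ] (G → ℂ) where
  toFun f := fun g => f (a * g * b)
  map_add' f₁ f₂ := by ext g; simp
  map_smul' c f := by ext g; simp

/-- A two-sided translate of a colouring-incidence test is again one:
`[c' ∘ (a g b) = c] = [(c' ∘ a) ∘ g = c ∘ b⁻¹]`. -/
theorem biTranslate_colourTest {n r : ℕ} (c c' : Fin n → Fin r) (a b : Equiv.Perm (Fin n)) :
    biTranslate a b (colourTest c c') =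
      colourTest (c ∘ ⇑(b⁻¹ : Equiv.Perm (Fin n))) (c' ∘ ⇑a) := by
  ext g
  simp only [biTranslate, LinearMap.coe_mk, AddHom.coe_mk, colourTest]
  have key : (c' ∘ ⇑(a * g * b) = c) ↔
      ((c' ∘ ⇑a) ∘ ⇑g = c ∘ ⇑(b⁻¹ : Equiv.Perm (Fin n))) := by
    constructor
    · intro h
      funext i
      have := congrFun h (b⁻¹ i)
      simp only [Function.comp_apply, Equiv.Perm.coe_mul] at this ⊢
      simpa using this
    · intro h
      funext i
      have := congrFun h (b i)
      simp only [Function.comp_apply, Equiv.Perm.coe_mul] at this ⊢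
      simpa using this
  by_cases h : c' ∘ ⇑(a * g * b) = c
  · rw [if_pos h, if_pos (key.mp h)]
  · rw [if_neg h, if_neg (fun h' => h (key.mpr h'))]

/-- **`J_r(n)` is bi-invariant** (the first clause of `GradedDesignFamily`, in its exact form). -/
theorem colourSpace_biInvariant (n r : ℕ) :
    ∀ f ∈ colourSpace n r, ∀ a b : Equiv.Perm (Fin n),
      (fun g : Equiv.Perm (Fin n) => f (a * g * b)) ∈ colourSpace n r := by
  intro f hf a b
  have hmap : Submodule.map (biTranslate a b) (colourSpace n r) ≤ colourSpace n r := by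
    unfold colourSpace
    rw [Submodule.map_span]
    apply Submodule.span_le.mpr
    rintro _ ⟨f, ⟨c, c', rfl⟩, rfl⟩
    exact Submodule.subset_span ⟨c ∘ ⇑(b⁻¹ : Equiv.Perm (Fin n)), c' ∘ ⇑a,
      biTranslate_colourTest c c' a b⟩
  exact hmap (Submodule.mem_map_of_mem hf)

/-- Right-translation invariance (the form the landed `packing_X` consumes). -/
theorem colourSpace_rightInvariant (n r : ℕ) :
    ∀ f ∈ colourSpace n r, ∀ h : Equiv.Perm (Fin n),
      (fun g : Equiv.Perm (Fin n) => f (g * h)) ∈ colourSpace n r := fun f hf h => by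
  simpa only [one_mul] using colourSpace_biInvariant n r f hf 1 h

/-- Left-translation invariance (the form the landed `packing_Z` consumes). -/
theorem colourSpace_leftInvariant (n r : ℕ) :
    ∀ f ∈ colourSpace n r, ∀ h : Equiv.Perm (Fin n),
      (fun g : Equiv.Perm (Fin n) => f (h * g)) ∈ colourSpace n r := fun f hf h => by
  simpa only [mul_one] using colourSpace_biInvariant n r f hf h 1

/-! ## Sanity of the objects (proved) -/

/-- The separation clause of this file IS the crux's clause at `J = J_r(n)` (and the `Sep` of the
Disproof file): definitional. -/
theorem colourSeparated_iff_sep (n r : ℕ) (X Y Z : Finset (Equiv.Perm (Fin n))) :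
    ColourSeparated n r X Y Z ↔
      ∀ x₀ ∈ X, ∀ z₀ ∈ Z, ∃ f ∈ colourSpace n r, ∀ x ∈ X, ∀ y ∈ Y, ∀ y' ∈ Y, ∀ z ∈ Z,
        (x = x₀ ∧ y = y' ∧ z = z₀ → f (x⁻¹ * y * y'⁻¹ * z) = 1) ∧
        (¬ (x = x₀ ∧ y = y' ∧ z = z₀) → f (x⁻¹ * y * y'⁻¹ * z) = 0) :=
  Iff.rfl

/-- The generating tests lie in the cell. -/
theorem colourTest_mem {n r : ℕ} (c c' : Fin n → Fin r) : colourTest c c' ∈ colourSpace n r :=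
  Submodule.subset_span ⟨c, c', rfl⟩

/-- `B_s(r,n) ≥ 0`. -/
theorem rowDegreeSum_nonneg (n r : ℕ) (s : ℝ) : 0 ≤ rowDegreeSum n r s := by
  unfold rowDegreeSum
  refine Finset.sum_nonneg fun μ _ => ?_
  split_ifs
  · exact Real.rpow_nonneg (Nat.cast_nonneg _) _
  · exact le_rfl

/-- `P(n) ≥ 0`. -/
theorem twoRowProxy_nonneg (n : ℕ) : 0 ≤ twoRowProxy n :=
  div_nonneg (pow_nonneg (by norm_num) n) (Real.rpow_nonneg (Nat.cast_nonneg n) _)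

/-- `P(n) > 0` for `n ≥ 1`. -/
theorem twoRowProxy_pos (n : ℕ) (hn : 1 ≤ n) : 0 < twoRowProxy n := by
  have h : (0 : ℝ) < n := by exact_mod_cast hn
  exact div_pos (pow_pos (by norm_num) n) (Real.rpow_pos_of_pos h _)

/-- `B_s(r,n) > 0` for `r, n ≥ 1` (the one-row shape `(n)` contributes `(f^{(n)})^s = 1`). -/
theorem rowDegreeSum_pos {r : ℕ} (hr : 1 ≤ r) (n : ℕ) (hn : 1 ≤ n) (s : ℝ) :
    0 < rowDegreeSum n r s := by
  classical
  unfold rowDegreeSum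
  have hcard : Multiset.card (Nat.Partition.indiscrete n).parts ≤ r := by
    rw [Nat.Partition.indiscrete_parts (by omega : n ≠ 0), Multiset.card_singleton]
    exact hr
  refine Finset.sum_pos' (fun μ _ => ?_) ⟨Nat.Partition.indiscrete n, Finset.mem_univ _, ?_⟩
  · split_ifs
    · exact Real.rpow_nonneg (Nat.cast_nonneg _) _
    · exact le_rfl
  · rw [if_pos hcard]
    have hf : 0 < numStandardTableaux (Nat.Partition.indiscrete n) :=
      Literature.NumberTheory.DiophantineGeometry.numStandardTableaux_pos_holds _
    exact Real.rpow_pos_of_pos (by exact_mod_cast hf) _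

/-! ## Tools for the lead (proved): the one-incidence certificate, TPP, and the walls -/

/-- **One-incidence certificate.**  If for every target `t = x₀⁻¹ z₀` there are colourings `c, c'`
with `c' ∘ t = c` such that NO other quadruple product `q = x⁻¹ y y'⁻¹ z` has `c' ∘ q = c`, the
triple is `r`-colour separated (the single test `[c' ∘ g = c] ∈ J_r(n)` separates).  At `r = 2`:
a set-image event `[g(A) = B]` through the target missing the rest of the quadruple set. -/
theorem colourSeparated_of_incidence {n r : ℕ} {X Y Z : Finset (Equiv.Perm (Fin n))}
    (h : ∀ x₀ ∈ X, ∀ z₀ ∈ Z, ∃ c c' : Fin n → Fin r, c' ∘ ⇑(x₀⁻¹ * z₀) = c ∧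
      ∀ x ∈ X, ∀ y ∈ Y, ∀ y' ∈ Y, ∀ z ∈ Z, ¬ (x = x₀ ∧ y = y' ∧ z = z₀) →
        c' ∘ ⇑(x⁻¹ * y * y'⁻¹ * z) ≠ c) :
    ColourSeparated n r X Y Z := by
  intro x₀ hx₀ z₀ hz₀
  obtain ⟨c, c', ht, hoff⟩ := h x₀ hx₀ z₀ hz₀
  refine ⟨colourTest c c', colourTest_mem c c', ?_⟩
  intro x hx y hy y' hy' z hz
  refine ⟨?_, fun hne => ?_⟩
  · rintro ⟨rfl, rfl, rfl⟩
    have e : x⁻¹ * y * y⁻¹ * z = x⁻¹ * z := by group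
    show (if c' ∘ ⇑(x⁻¹ * y * y⁻¹ * z) = c then (1 : ℂ) else 0) = 1
    rw [e, if_pos ht]
  · show (if c' ∘ ⇑(x⁻¹ * y * y'⁻¹ * z) = c then (1 : ℂ) else 0) = 0
    rw [if_neg (hoff x hx y hy y' hy' z hz hne)]

/-- **Young-TPP triples are `2`-colour separated** (lead c1; LANDED as the registered tool
`youngTPP_twoColourSeparated`, p103924, `Theorems/LevelGradedCohnUmansGradedDesignFamilyYoungTPP.lean`; the
separable-variable incidence certificate, see `colourSeparated_of_incidence`): if `x₀x⁻¹yy'⁻¹zz₀⁻¹`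
stabilises a subset `L ⊆ [n]` only in the diagonal case, then the single test
`[1_L ∘ x₀ ∘ g = 1_L ∘ z₀] ∈ J_2(n)` separates the target `(x₀, z₀)`; conversely an incidence design
whose domain-side test subset depends on `z₀` only and image side on `x₀` only IS a Young-TPP triple
(`z₀ α(z₀) = x₀ β(x₀)` forces one `L`).  So a Young-TPP family of volume `≥ P(n)^{3/2} n^{-a}`
discharges STUB C with no linear algebra (the lead's kit searches `htpp_search.py` explore exactly this
architecture; dead sub-architectures: fixed test subset `|Y||Z| ≤ C(n,⌊n/2⌋)`, box families, `Y`
inside a subgroup — evidence `stubC-architectures.md`). -/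
theorem colourSeparated_of_youngTPP {n : ℕ} (L : Finset (Fin n))
    {X Y Z : Finset (Equiv.Perm (Fin n))}
    (h : ∀ x₀ ∈ X, ∀ x ∈ X, ∀ y ∈ Y, ∀ y' ∈ Y, ∀ z ∈ Z, ∀ z₀ ∈ Z,
      Finset.image (⇑(x₀ * x⁻¹ * y * y'⁻¹ * z * z₀⁻¹)) L = L → x = x₀ ∧ y = y' ∧ z = z₀) :
    ColourSeparated n 2 X Y Z :=
  Summit.MatrixMultiplication.MatrixMultiplication.Theorems.GradedDesignFamily.youngTPP_twoColourSeparated L X Y Z h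

/-- Colour designs are TPP triples (the argument of the landed `SepImpliesTPP_proof`: evaluate the
separator of the target `(s, u')` at `(s, t, t, u')` and at `(s', t, t', u)`), so every catalogued
TPP volume cap (QuasirandomBarrier `BCGPU2023_thm32`, vacuous at `V ≍ 8^n ≪ (n!)^{3/2}`) applies. -/
theorem colourSeparated_tpp {n r : ℕ} {X Y Z : Finset (Equiv.Perm (Fin n))}
    (h : ColourSeparated n r X Y Z) :
    Literature.Combinatorics.Additive.TripleProductProperty X Y Z := by
  intro s hs s' hs' t ht t' ht' u hu u' hu' hprod
  obtain ⟨f, -, hf⟩ := h s hs u' hu'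
  have h1 : f (s⁻¹ * t * t⁻¹ * u') = 1 := (hf s hs t ht t ht u' hu').1 ⟨rfl, rfl, rfl⟩
  have hw : s'⁻¹ * t * t'⁻¹ * u = s⁻¹ * t * t⁻¹ * u' := by
    have hre : s'⁻¹ * t * t'⁻¹ * u = s⁻¹ * (s * s'⁻¹ * (t * t'⁻¹) * (u * u'⁻¹)) * u' := by group
    rw [hre, hprod]
    group
  by_contra hne
  have h0 : f (s'⁻¹ * t * t'⁻¹ * u) = 0 :=
    (hf s' hs' t ht t' ht' u hu).2 fun h' => hne ⟨h'.1.symm, h'.2.1, h'.2.2⟩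
  rw [hw, h1] at h0
  exact one_ne_zero h0

/-- **Graded Neumann count, `X`-slab**, for colour designs: `|X||Z| + |X|(|Y|-1) ≤ dim J_r(n)`. -/
theorem colourSeparated_packing_X {n r : ℕ} {X Y Z : Finset (Equiv.Perm (Fin n))}
    (h : ColourSeparated n r X Y Z) {y₁ z₁ : Equiv.Perm (Fin n)} (hy₁ : y₁ ∈ Y) (hz₁ : z₁ ∈ Z) :
    X.card * Z.card + X.card * (Y.card - 1) ≤ finrank ℂ (colourSpace n r) :=
  Summit.MatrixMultiplication.MatrixMultiplication.Theorems.LevelTwoBeatsCubes.Negative.packing_X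
    (colourSpace n r) (colourSpace_rightInvariant n r) X Y Z h hy₁ hz₁

/-- **Graded Neumann count, `Z`-slab**, for colour designs: `|X||Z| + (|Y|-1)|Z| ≤ dim J_r(n)`. -/
theorem colourSeparated_packing_Z {n r : ℕ} {X Y Z : Finset (Equiv.Perm (Fin n))}
    (h : ColourSeparated n r X Y Z) {x₁ y₁ : Equiv.Perm (Fin n)} (hx₁ : x₁ ∈ X) (hy₁ : y₁ ∈ Y) :
    X.card * Z.card + (Y.card - 1) * Z.card ≤ finrank ℂ (colourSpace n r) :=
  Summit.MatrixMultiplication.MatrixMultiplication.Theorems.LevelTwoBeatsCubes.Negative.packing_Z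
    (colourSpace n r) (colourSpace_leftInvariant n r) X Y Z h hx₁ hy₁

/-- **Walls** for colour designs: `(|X||Y||Z|)² ≤ (dim J_r(n))³` — the statement of the landed
`GradedDesignFamily.Negative.volume_sq_le_finrank_cube` at `J = J_r(n)`, re-derived from the two
slab counts by its own argument (`|X|(|Y|) ≤ D`, `|Y||Z| ≤ D`, `|X||Z| ≤ D`). -/
theorem colourSeparated_volume_sq_le {n r : ℕ} {X Y Z : Finset (Equiv.Perm (Fin n))}
    (h : ColourSeparated n r X Y Z) :
    (X.card * Y.card * Z.card) ^ 2 ≤ (finrank ℂ (colourSpace n r)) ^ 3 := by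
  classical
  rcases X.eq_empty_or_nonempty with rfl | ⟨x₁, hx₁⟩
  · simp
  rcases Y.eq_empty_or_nonempty with rfl | ⟨y₁, hy₁⟩
  · simp
  rcases Z.eq_empty_or_nonempty with rfl | ⟨z₁, hz₁⟩
  · simp
  have N1 := colourSeparated_packing_X h hy₁ hz₁
  have N2 := colourSeparated_packing_Z h hx₁ hy₁
  have ha : 1 ≤ X.card := Finset.card_pos.mpr ⟨x₁, hx₁⟩
  have hc : 1 ≤ Z.card := Finset.card_pos.mpr ⟨z₁, hz₁⟩
  obtain ⟨b, hbY⟩ : ∃ b, Y.card = b + 1 := ⟨Y.card - 1, by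
    have := Finset.card_pos.mpr ⟨y₁, hy₁⟩; omega⟩
  rw [hbY] at N1 N2 ⊢
  simp only [Nat.add_sub_cancel] at N1 N2
  set a := X.card
  set c := Z.card
  set D := finrank ℂ (colourSpace n r)
  have hab : a * (b + 1) ≤ D :=
    calc a * (b + 1) = a * b + a * 1 := by ring
      _ ≤ a * b + a * c := Nat.add_le_add_left (Nat.mul_le_mul_left a hc) _
      _ = a * c + a * b := Nat.add_comm _ _
      _ ≤ D := N1
  have hac : a * c ≤ D := le_trans (Nat.le_add_right _ _) N1
  have hbc : (b + 1) * c ≤ D :=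
    calc (b + 1) * c = 1 * c + b * c := by ring
      _ ≤ a * c + b * c := Nat.add_le_add_right (Nat.mul_le_mul_right c ha) _
      _ ≤ D := N2
  calc (a * (b + 1) * c) ^ 2 = (a * (b + 1)) * ((b + 1) * c) * (a * c) := by ring
    _ ≤ D * D * D := Nat.mul_le_mul (Nat.mul_le_mul hab hbc) hac
    _ = D ^ 3 := by ring

open scoped Classical in
/-- **Peter–Weyl, dimension form** (every finite group): a bi-invariant `J` lies in the span of the
matrix coefficients of the Wedderburn blocks whose characters it contains (the landed
`GradedPricing.le_repFun_charSupport`), so `dim J ≤ Σᶠ_{χ ∈ Irr(G) ∩ J} χ(1)²`.  The statement and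
the argument of the landed `GradedDesignFamily.Negative.finrank_le_gradedBudget_two`. -/
theorem finrank_le_budget_two {G : Type} [Group G] [Fintype G] (J : Submodule ℂ (G → ℂ))
    (hJ : ∀ f ∈ J, ∀ a b : G, (fun g : G => f (a * g * b)) ∈ J) :
    (finrank ℂ J : ℝ) ≤ (∑ᶠ χ ∈ irrChars G ∩ (J : Set (G → ℂ)), (χ 1).re ^ (2 : ℝ)) := by
  obtain ⟨k, d, hd, ⟨φ⟩⟩ := exists_algEquiv_pi_matrix G
  haveI := hd
  let ι := {i : Fin k // (blockRep φ i).character ∈ J}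
  let m : ι → ℕ := fun i => d i.1
  let ρ : ∀ i : ι, G →* Matrix.GeneralLinearGroup (Fin (m i)) ℂ := fun i =>
    ((((Pi.evalAlgHom ℂ (fun j : Fin k => Matrix (Fin (d j)) (Fin (d j)) ℂ) i.1).comp
      φ.toAlgHom).toMonoidHom).comp (MonoidAlgebra.of ℂ G)).toHomUnits
  have hle : J ≤ repFun m ρ := GradedPricing.le_repFun_charSupport φ J hJ
  let F : (Σ i : ι, Fin (m i) × Fin (m i)) → (G → ℂ) := fun q g =>
    ((ρ q.1 g : Matrix.GeneralLinearGroup (Fin (m q.1)) ℂ) : Matrix (Fin (m q.1)) (Fin (m q.1)) ℂ)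
      q.2.1 q.2.2
  have hspan : repFun m ρ = Submodule.span ℂ (Set.range F) := by
    unfold repFun
    congr 1
    ext ψ
    simp only [Set.mem_setOf_eq, Set.mem_range]
    constructor
    · rintro ⟨i, a, b, rfl⟩
      exact ⟨⟨i, (a, b)⟩, rfl⟩
    · rintro ⟨⟨i, a, b⟩, rfl⟩
      exact ⟨i, a, b, rfl⟩
  have h1 : finrank ℂ J ≤ finrank ℂ (repFun m ρ) := Submodule.finrank_mono hle
  have h2 : finrank ℂ (repFun m ρ) ≤ Fintype.card (Σ i : ι, Fin (m i) × Fin (m i)) := by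
    rw [hspan]
    exact finrank_range_le_card F
  have h3 : Fintype.card (Σ i : ι, Fin (m i) × Fin (m i)) = ∑ i : ι, (d i.1) ^ 2 := by
    rw [Fintype.card_sigma]
    refine Finset.sum_congr rfl fun i _ => ?_
    rw [Fintype.card_prod, Fintype.card_fin, sq]
  have h4 : ((∑ i : ι, (d i.1) ^ 2 : ℕ) : ℝ) = ∑ i : ι, ((d i.1 : ℕ) : ℝ) ^ (2 : ℝ) := by
    push_cast
    refine Finset.sum_congr rfl fun i _ => ?_
    rw [Real.rpow_two]
  have h5 := GradedPricing.sum_charSupport_rpow_le φ J 2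
  calc (finrank ℂ J : ℝ) ≤ ((∑ i : ι, (d i.1) ^ 2 : ℕ) : ℝ) := by
        exact_mod_cast h1.trans (h3 ▸ h2)
    _ = ∑ i : ι, ((d i.1 : ℕ) : ℝ) ^ (2 : ℝ) := h4
    _ ≤ _ := h5

/-- Under STUB A the dimension of the cell is at most its own wall: `dim J_r(n) ≤ D_r(n) = B_2(r,n)`
(Peter–Weyl, dimension form: landed `finrank_le_gradedBudget_two`). -/
theorem finrank_colourSpace_le (hA : ColourPricing) (n r : ℕ) :
    (finrank ℂ (colourSpace n r) : ℝ) ≤ rowDegreeSum n r 2 :=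
  le_trans (finrank_le_budget_two (colourSpace n r) (colourSpace_biInvariant n r)) (hA n r 2)

/-- Hence, under STUB A, every `r`-colour design obeys `(|X||Y||Z|)² ≤ D_r(n)³` — STUB C asks for a
constant fraction of `D_2(n)^{3/2} ≍ P(n)^{3/2}`, nothing the walls forbid. -/
theorem colourSeparated_volume_sq_le_rowDegreeSum (hA : ColourPricing) {n r : ℕ}
    {X Y Z : Finset (Equiv.Perm (Fin n))} (h : ColourSeparated n r X Y Z) :
    (((X.card * Y.card * Z.card) ^ 2 : ℕ) : ℝ) ≤ rowDegreeSum n r 2 ^ 3 := by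
  have h1 := colourSeparated_volume_sq_le h
  have h2 := finrank_colourSpace_le hA n r
  have h3 : (((X.card * Y.card * Z.card) ^ 2 : ℕ) : ℝ) ≤
      ((finrank ℂ (colourSpace n r) : ℕ) : ℝ) ^ 3 := by exact_mod_cast h1
  exact h3.trans (pow_le_pow_left₀ (Nat.cast_nonneg _) h2 3)

/-! ## The composition: the engine for an arbitrary wall function, then BY NAME for the crux -/

/-- Constant-factor families are wall families (for `n ≥ c^{-1/a}`, `n^{-a} ≤ c`). -/
theorem wallFamily_of_constant {r : ℕ} {W : ℕ → ℝ} (hW : ∀ n, 0 ≤ W n)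
    (h : ConstantWallFamily r W) : WallFamily r W := by
  obtain ⟨c, hc, hfam⟩ := h
  intro a ha n₀
  obtain ⟨M, hM⟩ : ∃ M : ℕ, ∀ n : ℕ, M ≤ n → (n : ℝ) ^ (-a) ≤ c := by
    refine ⟨⌈c ^ (-(1 / a))⌉₊ + 1, fun n hn => ?_⟩
    have hcpos : 0 < c ^ (-(1 / a)) := Real.rpow_pos_of_pos hc _
    have hlt : c ^ (-(1 / a)) < (n : ℝ) := by
      have h1 := Nat.le_ceil (c ^ (-(1 / a)))
      have h2 : ((⌈c ^ (-(1 / a))⌉₊ : ℕ) : ℝ) + 1 ≤ n := by exact_mod_cast hn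
      linarith
    have ha0 : a ≠ 0 := ne_of_gt ha
    calc (n : ℝ) ^ (-a) ≤ (c ^ (-(1 / a))) ^ (-a) :=
          Real.rpow_le_rpow_of_nonpos hcpos hlt.le (by linarith)
      _ = c := by
          rw [← Real.rpow_mul hc.le, show -(1 / a) * -a = 1 by field_simp, Real.rpow_one]
  obtain ⟨n, hn, X, Y, Z, hsep, hV⟩ := hfam (max n₀ M)
  refine ⟨n, le_trans (le_max_left _ _) hn, X, Y, Z, hsep, ?_⟩
  have hna : (n : ℝ) ^ (-a) ≤ c := hM n (le_trans (le_max_right _ _) hn)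
  have hW0 : 0 ≤ W n ^ ((3 : ℝ) / 2) := Real.rpow_nonneg (hW n) _
  calc W n ^ ((3 : ℝ) / 2) * (n : ℝ) ^ (-a) ≤ W n ^ ((3 : ℝ) / 2) * c :=
        mul_le_mul_of_nonneg_left hna hW0
    _ = c * W n ^ ((3 : ℝ) / 2) := mul_comm _ _
    _ ≤ _ := hV

/-- **The universality engine.**  Schur–Weyl pricing (A), a budget rate at level `r` against a
positive wall function `W` (B) and a `W`-wall family of `r`-colour designs within every polynomial
loss (C) give the graded design family (stated as the crux's body, verbatim) for EVERY `ε > 0`: with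
`s = 2 + ε`, B yields `K` and
`θ > 0`; run C with `a = 3θ/(2s)` past the threshold `n^{θ/2} > K`; the member at such an `n` has
`price ≤ B_s(r,n) ≤ K W^{s/2} n^{-θ} < W^{s/2} n^{-θ/2} = (W^{3/2} n^{-a})^{s/3} ≤ (|X||Y||Z|)^{s/3}`,
and `J = J_r(n)` is bi-invariant. -/
theorem gradedDesignFamily_of_wall {r : ℕ} {W : ℕ → ℝ} (hW : ∀ n : ℕ, 1 ≤ n → 0 < W n)
    (hA : ColourPricing) (hB : BudgetRate r W) (hC : WallFamily r W) :
    (∀ ε : ℝ, 0 < ε → ∃ (G : Type) (_ : Group G) (_ : Fintype G) (J : Submodule ℂ (G → ℂ))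
      (X Y Z : Finset G), (∀ f ∈ J, ∀ a b : G, (fun g : G => f (a * g * b)) ∈ J) ∧
      (∀ x₀ ∈ X, ∀ z₀ ∈ Z, ∃ f ∈ J, ∀ x ∈ X, ∀ y ∈ Y, ∀ y' ∈ Y, ∀ z ∈ Z,
        (x = x₀ ∧ y = y' ∧ z = z₀ → f (x⁻¹ * y * y'⁻¹ * z) = 1) ∧
        (¬ (x = x₀ ∧ y = y' ∧ z = z₀) → f (x⁻¹ * y * y'⁻¹ * z) = 0)) ∧
      (∑ᶠ χ ∈ irrChars G ∩ (J : Set (G → ℂ)), (χ 1).re ^ (2 + ε)) <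
        ((X.card * Y.card * Z.card : ℕ) : ℝ) ^ ((2 + ε) / 3)) := by
  -- (the conclusion is the BODY of `GradedDesignFamily`, verbatim; only `GradedDesignFamily_of`
  -- below concludes the crux by name, so that the skeleton check keys on it)
  intro ε hε
  have hs : (2 : ℝ) < 2 + ε := by linarith
  obtain ⟨K, θ, hθ, hK⟩ := hB (2 + ε) hs
  -- threshold: `n ≥ N ⇒ K < n^{θ/2}`
  obtain ⟨N, hN⟩ : ∃ N : ℕ, ∀ n : ℕ, N ≤ n → K < (n : ℝ) ^ (θ / 2) := by
    refine ⟨⌈(max K 1) ^ (2 / θ)⌉₊ + 1, fun n hn => ?_⟩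
    have hM : 0 ≤ max K 1 := le_trans zero_le_one (le_max_right _ _)
    have hlt : (max K 1) ^ (2 / θ) < (n : ℝ) := by
      have h1 := Nat.le_ceil ((max K 1) ^ (2 / θ))
      have h2 : ((⌈(max K 1) ^ (2 / θ)⌉₊ : ℕ) : ℝ) + 1 ≤ n := by exact_mod_cast hn
      linarith
    have hθ0 : θ ≠ 0 := ne_of_gt hθ
    calc K ≤ max K 1 := le_max_left _ _
      _ = ((max K 1) ^ (2 / θ)) ^ (θ / 2) := by
          rw [← Real.rpow_mul hM, show 2 / θ * (θ / 2) = 1 by field_simp, Real.rpow_one]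
      _ < (n : ℝ) ^ (θ / 2) := Real.rpow_lt_rpow (Real.rpow_nonneg hM _) hlt (by positivity)
  set a : ℝ := 3 * θ / (2 * (2 + ε)) with ha_def
  have ha : 0 < a := by positivity
  obtain ⟨n, hn, X, Y, Z, hsep, hV⟩ := hC a ha (max N 1)
  have hn1 : 1 ≤ n := le_trans (le_max_right _ _) hn
  have hnN : N ≤ n := le_trans (le_max_left _ _) hn
  have hnpos : (0 : ℝ) < n := by exact_mod_cast hn1
  have hWn : 0 < W n := hW n hn1
  refine ⟨Equiv.Perm (Fin n), inferInstance, inferInstance, colourSpace n r, X, Y, Z,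
    colourSpace_biInvariant n r, hsep, ?_⟩
  have h1 : colourBudget n r (2 + ε) ≤ rowDegreeSum n r (2 + ε) := hA n r (2 + ε)
  have h2 : rowDegreeSum n r (2 + ε) ≤ K * W n ^ ((2 + ε) / 2) * (n : ℝ) ^ (-θ) := hK n hn1
  have h3 : K * W n ^ ((2 + ε) / 2) * (n : ℝ) ^ (-θ) <
      W n ^ ((2 + ε) / 2) * (n : ℝ) ^ (-(θ / 2)) := by
    have hKlt : K < (n : ℝ) ^ (θ / 2) := hN n hnN
    have hpos1 : 0 < W n ^ ((2 + ε) / 2) := Real.rpow_pos_of_pos hWn _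
    have hpos2 : 0 < (n : ℝ) ^ (-(θ / 2)) := Real.rpow_pos_of_pos hnpos _
    have hpos3 : 0 < (n : ℝ) ^ (θ / 2) := Real.rpow_pos_of_pos hnpos _
    have e : (n : ℝ) ^ (-θ) = (n : ℝ) ^ (-(θ / 2)) * ((n : ℝ) ^ (θ / 2))⁻¹ := by
      rw [← Real.rpow_neg hnpos.le (θ / 2), ← Real.rpow_add hnpos]
      congr 1
      ring
    have hKC : K * ((n : ℝ) ^ (θ / 2))⁻¹ < 1 := by
      rw [mul_inv_lt_iff₀ hpos3, one_mul]
      exact hKlt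
    rw [e]
    calc K * W n ^ ((2 + ε) / 2) * ((n : ℝ) ^ (-(θ / 2)) * ((n : ℝ) ^ (θ / 2))⁻¹)
        = (K * ((n : ℝ) ^ (θ / 2))⁻¹) * (W n ^ ((2 + ε) / 2) * (n : ℝ) ^ (-(θ / 2))) := by
          ring
      _ < 1 * (W n ^ ((2 + ε) / 2) * (n : ℝ) ^ (-(θ / 2))) :=
          mul_lt_mul_of_pos_right hKC (mul_pos hpos1 hpos2)
      _ = W n ^ ((2 + ε) / 2) * (n : ℝ) ^ (-(θ / 2)) := one_mul _
  have h4 : W n ^ ((2 + ε) / 2) * (n : ℝ) ^ (-(θ / 2)) =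
      (W n ^ ((3 : ℝ) / 2) * (n : ℝ) ^ (-a)) ^ ((2 + ε) / 3) := by
    have h2ε : (2 : ℝ) + ε ≠ 0 := ne_of_gt (by linarith)
    rw [Real.mul_rpow (Real.rpow_nonneg hWn.le _) (Real.rpow_nonneg hnpos.le _),
      ← Real.rpow_mul hWn.le, ← Real.rpow_mul hnpos.le]
    congr 1
    · congr 1
      ring
    · congr 1
      rw [ha_def]
      field_simp
  have h5 : (W n ^ ((3 : ℝ) / 2) * (n : ℝ) ^ (-a)) ^ ((2 + ε) / 3) ≤
      ((X.card * Y.card * Z.card : ℕ) : ℝ) ^ ((2 + ε) / 3) :=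
    Real.rpow_le_rpow (mul_nonneg (Real.rpow_nonneg hWn.le _) (Real.rpow_nonneg hnpos.le _)) hV
      (by linarith)
  show colourBudget n r (2 + ε) < ((X.card * Y.card * Z.card : ℕ) : ℝ) ^ ((2 + ε) / 3)
  calc colourBudget n r (2 + ε) ≤ rowDegreeSum n r (2 + ε) := h1
    _ ≤ K * W n ^ ((2 + ε) / 2) * (n : ℝ) ^ (-θ) := h2
    _ < W n ^ ((2 + ε) / 2) * (n : ℝ) ^ (-(θ / 2)) := h3
    _ = (W n ^ ((3 : ℝ) / 2) * (n : ℝ) ^ (-a)) ^ ((2 + ε) / 3) := h4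
    _ ≤ ((X.card * Y.card * Z.card : ℕ) : ℝ) ^ ((2 + ε) / 3) := h5

/-- **`GradedDesignFamily_of`** — `stub_twoColourWallFamily → GradedDesignFamily` (the registered line,
`r = 2`, proxy wall `P(n) = 4^n/n^{3/2}`; Schur–Weyl pricing A and the two-row budget rate B are LANDED
and imported as `colourPricing_holds`, `twoRowBudgetRate_holds`): the two-colour wall family (C) is
priced by Schur–Weyl (A) and beats its budget for every `ε` by the two-row budget rate (B).
CLOSED MODULO THE ONE OPEN STUB C. -/
theorem GradedDesignFamily_of (h₃ : Registered.stub_twoColourWallFamily) :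
    Summit.MatrixMultiplication.MatrixMultiplication.Theses.LevelGradedCohnUmans.GradedDesignFamily :=
  gradedDesignFamily_of_wall twoRowProxy_pos colourPricing_holds twoRowBudgetRate_holds h₃

/-- Wiring check: the registered stubs feed `GradedDesignFamily_of` as stated. -/
example : Summit.MatrixMultiplication.MatrixMultiplication.Theses.LevelGradedCohnUmans.GradedDesignFamily :=
  GradedDesignFamily_of stub_twoColourWallFamily

/-- Constructors aiming at a CONSTANT fraction of the wall (card `C⁺⁺`) discharge STUB C. -/
theorem twoColourWallFamily_of_constant (h : TwoColourConstantFamily) : TwoColourWallFamily :=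
  wallFamily_of_constant twoRowProxy_nonneg h

/-! ## Reshape kept for the lead (proved, NOT registered): any fixed row level `r`

If the two-row cell dies by an `r = 2`-specific packing law, replace `2` by `r` and the proxy by the
abstract wall `D_r(n) = B_2(r,n)`: B becomes Regev's theorem with rate,
`B_s(r,n) ≤ K · D_r(n)^{s/2} · n^{-θ}` (truth: `θ = (r-1)(s-2)/4`; A. Regev, Adv. Math. 41 (1981),
strip sums), C the `D_r`-wall family within every polynomial loss.  Same engine. -/

/-- Regev universality (rate form) at row level `r` (FALSE for `r ≤ 1`: one block, no decay). -/
def RowUniversality (r : ℕ) : Prop :=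
  BudgetRate r (fun n => rowDegreeSum n r 2)

/-- A wall family at row level `r` against the true wall `D_r(n)`, within every polynomial loss. -/
def RowWallFamily (r : ℕ) : Prop :=
  WallFamily r (fun n => rowDegreeSum n r 2)

/-- **Reshape** `GradedDesignFamily_of_rows`: at any fixed `r ≥ 1`, Schur–Weyl pricing, Regev
universality and a `D_r`-wall family give the crux. -/
theorem GradedDesignFamily_of_rows (r : ℕ) (hr : 1 ≤ r) (hA : ColourPricing)
    (hB : RowUniversality r) (hC : RowWallFamily r) :
    (∀ ε : ℝ, 0 < ε → ∃ (G : Type) (_ : Group G) (_ : Fintype G) (J : Submodule ℂ (G → ℂ))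
      (X Y Z : Finset G), (∀ f ∈ J, ∀ a b : G, (fun g : G => f (a * g * b)) ∈ J) ∧
      (∀ x₀ ∈ X, ∀ z₀ ∈ Z, ∃ f ∈ J, ∀ x ∈ X, ∀ y ∈ Y, ∀ y' ∈ Y, ∀ z ∈ Z,
        (x = x₀ ∧ y = y' ∧ z = z₀ → f (x⁻¹ * y * y'⁻¹ * z) = 1) ∧
        (¬ (x = x₀ ∧ y = y' ∧ z = z₀) → f (x⁻¹ * y * y'⁻¹ * z) = 0)) ∧
      (∑ᶠ χ ∈ irrChars G ∩ (J : Set (G → ℂ)), (χ 1).re ^ (2 + ε)) <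
        ((X.card * Y.card * Z.card : ℕ) : ℝ) ^ ((2 + ε) / 3)) :=
  -- (= the body of `GradedDesignFamily`; feed it to the crux by `exact` once the reshape is adopted)
  gradedDesignFamily_of_wall (fun n hn => rowDegreeSum_pos hr n hn 2) hA hB hC

end Summit.MatrixMultiplication.MatrixMultiplication.Cruxes.GradedDesignFamily.SchurWeylColourCells

end
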